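import Summits.QuantumFields.YangMills.Theorems.BalabanUVNodesKLCOfB7Prop5Vacuous
import Literature.MathematicalPhysics.QuantumFieldTheory.Balaban1983to89.Node00.BgAveragingPrOfRecord
import Summits.QuantumFields.YangMills.Theorems.BalabanUVNodesC44IterMhConePr
import HarnessLib

/-!
# [B7] PROP. 5 AT THE RECORD ON THE FRAMED CHART, BY NAME — the re-pressed instance `kexpOfRecordPr F N 𝔥 : KRecIdx F → B7.KExp` over a frame family `𝔥` (def-Y's `FrameDatum`,
# edition (ρ-frame-min)) and the door (KL-C)^{pr} ⇐ `B7.Prop5Printed (kexpOfRecordPr F N 𝔥)`: the on-cone entry letter of `D C^{𝔰𝔩,pr}` with `g₀ := C₃η_k^d`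

Cell `pub-ymgap` ∕ `ym-nodeO-ideate`, porter hand `hand-27238-KLC` (g2; ★★★ director-ym №601∕№605∕№608 ROAD WORD FINAL «(ρ-frame-min) keyed on C's chart», row (c) re-press (B) behind
def-Y's ✓`Node00/BgAveragingPrOfRecord`); `--supports stmt-QuantumFields-27238 --as helper`; count-neutral.  [B7] = [Balaban1985Averaging]; [B9] = [Balaban1985BackgroundPropagators];
[B11] = [Balaban1985Variational]; [RG1] = [Balaban1987RG1].  Memo: `Cruxes/Record13SepCoPHInhabitedAx/Lines/KLC-kexpOfRecord-hand.md` (g0 v1.4 + g2 §Q-37′).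

WHY A RE-PRESS (located, Q-37 ∕ Q-38D, nodeO STATUS l.5767–l.5889).  g0's ✓`kexpOfRecord` (file `…KLCOfB7Prop5`) reads the FRAME-FREE chart `C^{𝔰𝔩} = CslOfRecord` ∕ `Q_k(U₀) = qCplxOp`: the (0.4)
average answers a one-site gauge mode at a `k`-block centre with amplitude `η_k` (✓`iterMh_gaugeSL`), so `B7.Prop5Printed (kexpOfRecord F N)` is FALSE at scale (✓`not_B7Prop5Printed_kexpOfRecord`,
file `…Vacuous`) and the frame-free door is vacuous.  Print's `Q_k`, `C_k` of [B7] Sect. C–D are the FRAMED («double-bar») letters: [B7] (92) p.31 `Ū^k = v(b₋)·(R^kU)·v(b₊)⁻¹` with the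
hierarchical frames `v` of (78)–(87)∕(97); [B9] (3.113)–(3.114) p.418.  def-Y's `FrameDatum (F.P K) N k U₀ = ⟨dom, map, inv, analyticity, map_mul_inv, map_bg, deriv, hasFDerivAt_map⟩` (file `Node00/BgAveragingPrOfRecord`) is the INTERFACE of such a frame,
`avPrM 𝔥 V c := 𝔥.map V c.src · Ū^k_h(V)(c) · 𝔥.inv V c.tgt` the framed average, `qPrCplxOp k U₀ 𝔥 = qCplxOp k U₀ − frameCorr ∘ 𝔥.deriv ∘ leftVelC` the framed linearisation («`Q^{pr} = q^{ff} − ∂∘Dh`»), `CprOfRecord` ∕ `CslprOfRecord … 𝔥 levB` the framed remainder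
(`COfRecord` verbatim with `iterMh ↦ avPrM 𝔥`, `qCplxOp ↦ qPrCplxOp`).  THIS FILE re-keys g0's family and door on those letters, for a frame FAMILY `𝔥 K k U₀` given as a PARAMETER (not an index
field: the constants of Prop. 5 are uniform over the index, and an index ranging over frames would include the frameless datum, refuted by Q-37).

THE SIX-FIELD DICTIONARY (unchanged from g0 except the chart): `Cfg := GaugeField (F.P K) 0 (SU N)`; `Fld := Bond d (sitesPerDir 0) → M_N(ℂ)` (read through `P = slProjLit`); `plaqDevEta U₀ :=
η_k⁻²·⨆_p‖U₀(∂p) − 1‖` ((52)); `fldNorm A := sup_b‖A(b)‖`; `dQk U₀ A`, `dCk U₀ A := η_k^{−d}·` the operator norm of `X ↦ (D Q^{𝔰𝔩,pr}_k(U₀, η·)(A)·δ_bX)(c)` resp. `X ↦ (D C^{𝔰𝔩,pr}(A)·δ_bX)(c)`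
((138)), `Q^{𝔰𝔩,pr}_k(U₀, ηA) := C^{𝔰𝔩,pr}(A) + Q^{pr}_k(U₀)(PA)` ((134)); `remCk`, `IsAnalyticQk` likewise; NOT MODELLED (Props. 6–7 only): `pert U₀ A′ := U₀`, `avgRatioDev := 0`,
`IsJointlyAnalytic := True` — `B7.Prop6Printed ∕ Prop7Printed (kexpOfRecordPr …)` are NOT print's statements.  Divergences D1 (fibre `M_N(ℂ)` via `P`), D2 (torus ∕ centred blocks), D3a ((0.4) vs
(14)–(15) averaging — print asserts the extension, B7 p.20 ∕ RG1 p.253), D4 (total functions, junk off the guards) as in g0's memo §2; D3b (frame-free chart) is REMOVED by construction — modulo the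
inhabitant: the letters here are over an ARBITRARY datum `𝔥`.

STATUS OF THE HYPOTHESIS `B7.Prop5Printed (kexpOfRecordPr F N 𝔥)` — DEPENDS ON THE FRAME FAMILY (honest, kernel): for the FRAMELESS datum family (def-Y's `FrameDatum.frameless k U₀`: `h = h⁻¹ = 1`, `Dh = 0`) the family IS
g0's `kexpOfRecord F N` (`kexpOfRecordPr_frameless`, §6) and the hypothesis is FALSE for `N ≥ 2` (`not_B7Prop5Printed_kexpOfRecordPr_frameless` ⇐ ✓`not_B7Prop5Printed_kexpOfRecord`); the ROAD
instance is def-Y's record inhabitant `hierFrameDatumOfRecord` (file A1 of the edition, validation targets (V1) `qPrCplxOp k 1 (…) = Q^{str}_k` ∕ (V2) `FrameIntertwinesTok`), for which the Q-37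
witness chain is dead (g2's pen check Q-37′, nodeO STATUS 2026-08-31T16:28:46Z: first order `η_k^{d+1}λ`, second order `0` ∕ `O(η_k^{d+1})`) and the hypothesis is print's Prop. 5 for the record's
(0.4) averaging — an UNPROVED printed statement (dictionary row (d3): TRANSPORT of lit's ✓`prop5_general_157_printed`, XL, unowned).

WHAT THIS FILE PROVES (1 def `kexpOfRecordPr`; unfolding `rfl`s; glue):
§2 `plaqDevEta_lt_of_plaqSmall_pr` ((52) ⇐ `PlaqSmall (αη_k²) U₀`), §3 ★ `entry_le_of_dCk_le_pr` (`dCk ≤ C₃|A|` IS `‖(D C^{𝔰𝔩,pr}(A)·δ_bX)(c)‖ ≤ C₃η_k^d|A|‖X‖`, `le_opNorm`),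
§4 ★★ `coneLetter_of_prop5Clause_pr` (the on-cone entry letter `g₀ := C₃η_k^d` on `‖A‖ < α₁` from the (157) CLAUSE at `(α₀, α₁, C₃)`), ★★★ `klC_of_B7Prop5Printed_pr` (BY NAME:
`B7.Prop5Printed (kexpOfRecordPr F N 𝔥) → ∃ C₃ c₅ > 0, ∀ K k Ω U₀ levB …` = the `hg` binder of PT-B's re-pressed cone doors `…ConePr` at `𝔥 K k U₀`), §6 the frameless honesty clause (over def-Y's `FrameDatum.frameless`) and the (157)-at-0 row `kexpOfRecordPr_dCk_zero` (every datum, under the guard).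
§5 (hand g2, appended behind PT-B's ✓`…C44IterMhConePr`): ★★ `kernelLetterC_of_prop5Clause_pr` (G1's (KL-C)ᵖʳ triple via ✓`kernelLetterC_of_conePr`) and ★★★ `prop4UniformPrAtRecord_node00_of_prop5Clause_pr`
([B11] Prop. 4 at the record, node-00, framed, via ✓`prop4UniformPrAtRecord_node00_of_coneLetterPr` with its (KL-C)ᵖʳ block := the (157) clause at `(α, α₁, C₃)`, `r + r ≤ α₁`).
By-name use downstream: `obtain ⟨C₁', C₃, c₅, -, hC₃, hc₅, h⟩ := h5`, `h157 := fun i U₀ hU A hA => (h i α α₁ hα hα5 hα₁ hα₁5 U₀ hU A hA).2`.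

HONEST FRAMING.  A typed INSTANCE over a frame datum + bookkeeping ((138) + `le_opNorm` + top-level weights); NO estimate of Bałaban is proved; NO frame is CONSTRUCTED here (def-Y's A1);
`B7.Prop5Printed (kexpOfRecordPr F N 𝔥)` is an UNPROVED printed statement used as a HYPOTHESIS whose truth depends on `𝔥` (false frameless; print's Prop. 5 at the record's frame).  JUNCTION PIN
(◆ CRIT-1 cut of this file): whoever consumes `klC_of_B7Prop5Printed_pr` toward K0ᴬ states it at the RECORD's frame family `𝔥 := fun K k U₀ => hierFrameDatumOfRecord F N K k U₀` (def-Y's A1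
inhabitant, validation targets (V1)∕(V2)) — NEVER at a variable family and never at the frameless one (§6).  (ℓa-H),
(KL-H), (KL-N) and the Prop-4 window stay DISPLAYED in the consumers; K0ᴬ ⟨stmt-QuantumFields-27238⟩ NOT closed; K0ᴬ∕K1ᴬ∕K3ᴬ 0∕3; NODE O 0∕1; COUNT 8∕28 · K 1∕4 UNMOVED; finite `𝕋⁴_{L^K}` at
fixed ε — NOT continuum ∕ ℝ⁴ ∕ OS; **the Yang–Mills mass gap (Clay) is NOT proved by any of this.**  No `sorry`, `instance`, `notation`, `set_option`; standard axioms.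
-/

noncomputable section

open scoped Matrix Matrix.Norms.L2Operator InnerProductSpace ComplexConjugate BigOperators
open Classical

namespace Summit.QuantumFields.YangMills.Theorems.KExpOfRecordPr

open Literature.MathematicalPhysics.QuantumFieldTheory.Balaban1983to89
open Literature.MathematicalPhysics.QuantumFieldTheory.Balaban1983to89.Node00
open Summit.QuantumFields.YangMills.Theorems.KExpOfRecord (KRecIdx kexpOfRecord pi_norm_le_norm115 not_B7Prop5Printed_kexpOfRecord)
open T4Continuum BlockAveraging
open B10Eq42TorusConstraint (bondsIn)
open B10Eq38TorusDomains (toFine)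
open B11Eq103H1Complex (SiteL2K)
open B9SectCLatticeCarrier (Bond)
open B11Eq115Space (NegSup NegSize JetSup levWeight levWeight_apply)
open B11Eq90Transpose (single115)
open B11Eq90V0primeCurrent (flat115)
open B11Eq111FrakG (nabla115)
open B15AveragingHolomorphic (iterMh)

variable (F : T4Family) (N : ℕ) [NeZero N]

/-! ## §1  The framed family over a frame datum family `𝔥` -/

/-- ★★ **THE RECORD INSTANCE OF [B7]'s ABSTRACT `k`-FOLD CARRIER ON THE FRAMED CHART** at index `i = (K, k, Ω, levB; c; b)`, over a FRAME FAMILY `𝔥 K k U₀ : FrameDatum (F.P K) N k U₀` (def-Y's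
interface of print's hierarchical frames; the record's inhabitant is def-Y's `hierFrameDatumOfRecord`): g0's ✓`kexpOfRecord` with the frame-free letters replaced by the framed ones —
`C^{𝔰𝔩,pr} = CslprOfRecord … (𝔥 K k U₀) levB`, `Q^{pr}_k(U₀) = qPrCplxOp k U₀ (𝔥 K k U₀)` — in `IsAnalyticQk`, `remCk`, `dQk`, `dCk`; `Cfg`, `Fld`, `k`, `plaqDevEta` ((52)), `fldNorm` (`sup_b|A(b)|`)
unchanged; `dQk`∕`dCk := η_k^{−d}·` the operator norm of the `(c, b)` entry of the derivative ((137)–(138)); NOT MODELLED (Props. 6–7 only): `pert U₀ A′ := U₀`, `avgRatioDev := 0`, `IsJointlyAnalytic := True`.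
[cite: Balaban1985Averaging, (52) p.26, (92) p.31, (127) p.37, (134)–(135) pp.38–39, (137)–(138) p.39, Proposition 5 (156)–(157) p.42; Balaban1985BackgroundPropagators, (3.113)–(3.114) p.418; Balaban1985Variational, (44) p.285, (72) p.289] -/
def kexpOfRecordPr (𝔥 : ∀ (K k : ℕ) (U₀ : GaugeField (F.P K) 0 (SU N)), FrameDatum (F.P K) N k U₀) (i : KRecIdx F) : B7.KExp :=
  haveI : Fact (0 < (F.L : ℝ)) := factL F
  haveI : Fact (0 < (F.P i.K).eta i.k) := factEta F i.K i.k
  { Cfg := GaugeField (F.P i.K) 0 (SU N)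
    Fld := Bond (F.P i.K).d (fun _ => (F.P i.K).sitesPerDir 0) → Matrix (Fin N) (Fin N) ℂ
    k := i.k
    plaqDevEta := fun U₀ => ((F.P i.K).eta i.k ^ 2)⁻¹ * ⨆ p : Plaq (F.P i.K) 0, dist1 (GaugeField.plaqHol U₀ p)
    fldNorm := fun A => ‖A‖
    IsAnalyticQk := fun U₀ r =>
      AnalyticOnNhd ℂ
        (fun A' : Space115Lit F N i.K i.k i.Ω U₀ =>
          NegSup.equiv (levWeight (F.L : ℝ) ((F.P i.K).eta i.k) i.levB 0) (Matrix (Fin N) (Fin N) ℂ)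
            (CslprOfRecord F N i.K i.k i.Ω U₀ (𝔥 i.K i.k U₀) i.levB A' +
              (NegSup.equiv (levWeight (F.L : ℝ) ((F.P i.K).eta i.k) i.levB 0) (Matrix (Fin N) (Fin N) ℂ)).symm
                (qPrCplxOp i.k U₀ (𝔥 i.K i.k U₀) (evLit F N i.K i.k i.Ω U₀ (slProjLit F N i.K i.k i.Ω U₀ A')))) i.c)
        {A' | ‖flat115 A'‖ < r}
    remCk := fun U₀ A =>
      ‖NegSup.equiv (levWeight (F.L : ℝ) ((F.P i.K).eta i.k) i.levB 0) (Matrix (Fin N) (Fin N) ℂ)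
        (CslprOfRecord F N i.K i.k i.Ω U₀ (𝔥 i.K i.k U₀) i.levB
          ((JetSup.equiv (levWeight (F.L : ℝ) ((F.P i.K).eta i.k) (bondLevLit F i.Ω i.k) 1) (levWeight (F.L : ℝ) ((F.P i.K).eta i.k) (pairLevLit F i.Ω i.k) 2)
            (nabla115 ((F.P i.K).eta i.k) (unitsOfRecord F N U₀))).symm A)) i.c‖
    dQk := fun U₀ A =>
      ((F.P i.K).eta i.k ^ (F.P i.K).d)⁻¹ *
        ‖(NegSup.evalCLM ℂ (levWeight (F.L : ℝ) ((F.P i.K).eta i.k) i.levB 0) i.c).comp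
          ((fderiv ℂ
              (fun A' : Space115Lit F N i.K i.k i.Ω U₀ =>
                CslprOfRecord F N i.K i.k i.Ω U₀ (𝔥 i.K i.k U₀) i.levB A' +
                  (NegSup.equiv (levWeight (F.L : ℝ) ((F.P i.K).eta i.k) i.levB 0) (Matrix (Fin N) (Fin N) ℂ)).symm
                    (qPrCplxOp i.k U₀ (𝔥 i.K i.k U₀) (evLit F N i.K i.k i.Ω U₀ (slProjLit F N i.K i.k i.Ω U₀ A'))))
              ((JetSup.equiv (levWeight (F.L : ℝ) ((F.P i.K).eta i.k) (bondLevLit F i.Ω i.k) 1) (levWeight (F.L : ℝ) ((F.P i.K).eta i.k) (pairLevLit F i.Ω i.k) 2)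
                (nabla115 ((F.P i.K).eta i.k) (unitsOfRecord F N U₀))).symm A)).comp
            (single115 (lev₁ := pairLevLit F i.Ω i.k) (Dc := nabla115 ((F.P i.K).eta i.k) (unitsOfRecord F N U₀)) i.b))‖
    dCk := fun U₀ A =>
      ((F.P i.K).eta i.k ^ (F.P i.K).d)⁻¹ *
        ‖(NegSup.evalCLM ℂ (levWeight (F.L : ℝ) ((F.P i.K).eta i.k) i.levB 0) i.c).comp
          ((fderiv ℂ (CslprOfRecord F N i.K i.k i.Ω U₀ (𝔥 i.K i.k U₀) i.levB)
              ((JetSup.equiv (levWeight (F.L : ℝ) ((F.P i.K).eta i.k) (bondLevLit F i.Ω i.k) 1) (levWeight (F.L : ℝ) ((F.P i.K).eta i.k) (pairLevLit F i.Ω i.k) 2)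
                (nabla115 ((F.P i.K).eta i.k) (unitsOfRecord F N U₀))).symm A)).comp
            (single115 (lev₁ := pairLevLit F i.Ω i.k) (Dc := nabla115 ((F.P i.K).eta i.k) (unitsOfRecord F N U₀)) i.b))‖
    pert := fun U₀ _ => U₀
    avgRatioDev := fun _ _ => 0
    IsJointlyAnalytic := fun _ _ _ => True }

variable (𝔥 : ∀ (K k : ℕ) (U₀ : GaugeField (F.P K) 0 (SU N)), FrameDatum (F.P K) N k U₀)

/-- Unfolding of the `dCk` field (`rfl`). [cite: Balaban1985Averaging, (157) p.42, (138) p.39 (bookkeeping)] -/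
theorem kexpOfRecordPr_dCk (i : KRecIdx F) (U₀ : GaugeField (F.P i.K) 0 (SU N))
    (A : Bond (F.P i.K).d (fun _ => (F.P i.K).sitesPerDir 0) → Matrix (Fin N) (Fin N) ℂ) :
    haveI : Fact (0 < (F.L : ℝ)) := factL F
    haveI : Fact (0 < (F.P i.K).eta i.k) := factEta F i.K i.k
    (kexpOfRecordPr F N 𝔥 i).dCk U₀ A =
      ((F.P i.K).eta i.k ^ (F.P i.K).d)⁻¹ *
        ‖(NegSup.evalCLM ℂ (levWeight (F.L : ℝ) ((F.P i.K).eta i.k) i.levB 0) i.c).comp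
          ((fderiv ℂ (CslprOfRecord F N i.K i.k i.Ω U₀ (𝔥 i.K i.k U₀) i.levB)
              ((JetSup.equiv (levWeight (F.L : ℝ) ((F.P i.K).eta i.k) (bondLevLit F i.Ω i.k) 1) (levWeight (F.L : ℝ) ((F.P i.K).eta i.k) (pairLevLit F i.Ω i.k) 2)
                (nabla115 ((F.P i.K).eta i.k) (unitsOfRecord F N U₀))).symm A)).comp
            (single115 (lev₁ := pairLevLit F i.Ω i.k) (Dc := nabla115 ((F.P i.K).eta i.k) (unitsOfRecord F N U₀)) i.b))‖ := rfl

/-- Unfolding of the `fldNorm` field: print's `|A| = sup_b |A_b|` (`rfl`). [cite: Balaban1985Averaging, (110) p.35, (52) p.26 (bookkeeping)] -/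
theorem kexpOfRecordPr_fldNorm (i : KRecIdx F) (A : Bond (F.P i.K).d (fun _ => (F.P i.K).sitesPerDir 0) → Matrix (Fin N) (Fin N) ℂ) :
    (kexpOfRecordPr F N 𝔥 i).fldNorm A = ‖A‖ := rfl

/-- The `plaqDevEta` field is the frame-free family's ((52) does not read the chart; `rfl`). [cite: Balaban1985Averaging, (52) p.26 (bookkeeping)] -/
theorem kexpOfRecordPr_plaqDevEta (i : KRecIdx F) (U₀ : GaugeField (F.P i.K) 0 (SU N)) :
    (kexpOfRecordPr F N 𝔥 i).plaqDevEta U₀ = (kexpOfRecord F N i).plaqDevEta U₀ := rfl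

/-! ## §2  (52) from `PlaqSmall` -/

/-- **(52) ⇐ THE RECORD's SMALL-FIELD PREDICATE** (g0's `plaqDevEta_lt_of_plaqSmall` re-read: the field is the same). [cite: Balaban1985Averaging, (52) p.26] -/
theorem plaqDevEta_lt_of_plaqSmall_pr (i : KRecIdx F) {α : ℝ} (hα : 0 < α) {U₀ : GaugeField (F.P i.K) 0 (SU N)}
    (hU : PlaqSmall (α * (F.P i.K).eta i.k ^ 2) U₀) : (kexpOfRecordPr F N 𝔥 i).plaqDevEta U₀ < α := by
  rw [kexpOfRecordPr_plaqDevEta]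
  exact KExpOfRecord.plaqDevEta_lt_of_plaqSmall F N i hα hU

/-! ## §3  The entry step on the framed chart: `dCk ≤ C₃|A|` IS `‖(D C^{𝔰𝔩,pr}(A)·δ_b X)(c)‖ ≤ C₃η^d·|A|·|X|` -/

variable {F N} in
/-- ★ **THE ENTRY STEP ON THE FRAMED CHART** ((137)–(138): partial derivative = `η^d ×` functional derivative): at index `i = (K, k, Ω, levB; c; b)`, the field bound `dCk U₀ A ≤ C₃·sup_b|A(b)|`
IS the per-entry bound `‖(D C^{𝔰𝔩,pr}(A)·δ_b X)(c)‖ ≤ C₃η_k^d·sup_b|A(b)|·|X|` for every `X ∈ M_N(ℂ)` (`le_opNorm`). [cite: Balaban1985Averaging, Proposition 5 (157) p.42, (137)–(138) p.39; Balaban1985Variational, (72) p.289] -/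
theorem entry_le_of_dCk_le_pr {K k : ℕ} (hk : k ≤ (F.P K).m + (F.P K).K) {Ω : ℕ → Set (Site (F.P K) 0)} {U₀ : GaugeField (F.P K) 0 (SU N)} [Fact (0 < (F.L : ℝ))] [Fact (0 < (F.P K).eta k)]
    (levB : PBond (F.P K) k → ℕ) (c : PBond (F.P K) k) (bb : Bond (F.P K).d (fun _ => (F.P K).sitesPerDir 0)) {C₃ : ℝ} {A : Space115Lit F N K k Ω U₀}
    (h : (kexpOfRecordPr F N 𝔥 ⟨K, k, hk, Ω, levB, c, bb⟩).dCk U₀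
        (JetSup.equiv (levWeight (F.L : ℝ) ((F.P K).eta k) (bondLevLit F Ω k) 1) (levWeight (F.L : ℝ) ((F.P K).eta k) (pairLevLit F Ω k) 2) (nabla115 ((F.P K).eta k) (unitsOfRecord F N U₀)) A) ≤
      C₃ * ‖JetSup.equiv (levWeight (F.L : ℝ) ((F.P K).eta k) (bondLevLit F Ω k) 1) (levWeight (F.L : ℝ) ((F.P K).eta k) (pairLevLit F Ω k) 2) (nabla115 ((F.P K).eta k) (unitsOfRecord F N U₀)) A‖)
    (X : Matrix (Fin N) (Fin N) ℂ) :
    ‖NegSup.equiv (levWeight (F.L : ℝ) ((F.P K).eta k) levB 0) (Matrix (Fin N) (Fin N) ℂ)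
        (fderiv ℂ (CslprOfRecord F N K k Ω U₀ (𝔥 K k U₀) levB) A (single115 (lev₁ := pairLevLit F Ω k) (Dc := nabla115 ((F.P K).eta k) (unitsOfRecord F N U₀)) bb X)) c‖ ≤
      C₃ * (F.P K).eta k ^ (F.P K).d *
        ‖JetSup.equiv (levWeight (F.L : ℝ) ((F.P K).eta k) (bondLevLit F Ω k) 1) (levWeight (F.L : ℝ) ((F.P K).eta k) (pairLevLit F Ω k) 2) (nabla115 ((F.P K).eta k) (unitsOfRecord F N U₀)) A‖ * ‖X‖ := by
  rw [kexpOfRecordPr_dCk] at h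
  dsimp only at h
  rw [Equiv.symm_apply_apply] at h
  have hη : 0 < (F.P K).eta k ^ (F.P K).d := pow_pos Fact.out _
  rw [inv_mul_le_iff₀ hη] at h
  set T := (NegSup.evalCLM ℂ (levWeight (F.L : ℝ) ((F.P K).eta k) levB 0) c).comp
    ((fderiv ℂ (CslprOfRecord F N K k Ω U₀ (𝔥 K k U₀) levB) A).comp (single115 (lev₁ := pairLevLit F Ω k) (Dc := nabla115 ((F.P K).eta k) (unitsOfRecord F N U₀)) bb)) with hT
  have hTX : NegSup.equiv (levWeight (F.L : ℝ) ((F.P K).eta k) levB 0) (Matrix (Fin N) (Fin N) ℂ)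
      (fderiv ℂ (CslprOfRecord F N K k Ω U₀ (𝔥 K k U₀) levB) A (single115 (lev₁ := pairLevLit F Ω k) (Dc := nabla115 ((F.P K).eta k) (unitsOfRecord F N U₀)) bb X)) c = T X := rfl
  rw [hTX]
  calc ‖T X‖ ≤ ‖T‖ * ‖X‖ := T.le_opNorm X
    _ ≤ ((F.P K).eta k ^ (F.P K).d * (C₃ * ‖JetSup.equiv (levWeight (F.L : ℝ) ((F.P K).eta k) (bondLevLit F Ω k) 1) (levWeight (F.L : ℝ) ((F.P K).eta k) (pairLevLit F Ω k) 2)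
          (nabla115 ((F.P K).eta k) (unitsOfRecord F N U₀)) A‖)) * ‖X‖ := mul_le_mul_of_nonneg_right h (norm_nonneg X)
    _ = _ := by ring

/-! ## §4  (KL-C)^{pr} — the on-cone entry letter of the framed chart — from the (157) clause, and BY NAME from `B7.Prop5Printed (kexpOfRecordPr F N 𝔥)` -/

/-- ★★ **(KL-C)^{pr} FROM THE (157) CLAUSE OF `B7.Prop5Printed (kexpOfRecordPr F N 𝔥)` AT FIXED CONSTANTS** (node-00 regime: `k ≤ m + K`, every site in `Ω_k`): if `U₀` satisfies (52) with `α₀`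
(`PlaqSmall (α₀η_k²) U₀`, `0 < α₀`) and (157) holds over the family at `(α₀, α₁, C₃)`, then for EVERY `‖A‖ < α₁`, every fine bond `b`, `X ∈ M_N(ℂ)` and coarse bond `c`:
`‖(D C^{𝔰𝔩,pr}(A)·δ_b X)(c)‖ ≤ C₃η_k^d·‖A‖·‖X‖` — the letter `g₀ := C₃η^d` of the re-pressed cone doors (asked there only on the cone).
[cite: Balaban1985Averaging, Proposition 5 (157) p.42, (138) p.39; Balaban1985Variational, (72)–(73) p.289] -/
theorem coneLetter_of_prop5Clause_pr {K k : ℕ} (hk : k ≤ (F.P K).m + (F.P K).K) {Ω : ℕ → Set (Site (F.P K) 0)} {U₀ : GaugeField (F.P K) 0 (SU N)}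
    [Fact (0 < (F.L : ℝ))] [Fact (0 < (F.P K).eta k)] (levB : PBond (F.P K) k → ℕ) (hΩ : ∀ x, x ∈ Ω k) {C₃ α₀ α₁ : ℝ} (hC₃ : 0 ≤ C₃) (hα₀ : 0 < α₀)
    (h157 : ∀ (i : KRecIdx F) (U₀ : (kexpOfRecordPr F N 𝔥 i).Cfg), (kexpOfRecordPr F N 𝔥 i).plaqDevEta U₀ < α₀ →
      ∀ A : (kexpOfRecordPr F N 𝔥 i).Fld, (kexpOfRecordPr F N 𝔥 i).fldNorm A < α₁ → (kexpOfRecordPr F N 𝔥 i).dCk U₀ A ≤ C₃ * (kexpOfRecordPr F N 𝔥 i).fldNorm A)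
    (hU₀ : PlaqSmall (α₀ * (F.P K).eta k ^ 2) U₀) :
    ∀ A : Space115Lit F N K k Ω U₀, ‖A‖ < α₁ → ∀ (bb : Bond (F.P K).d (fun _ => (F.P K).sitesPerDir 0)) (X : Matrix (Fin N) (Fin N) ℂ) (c : PBond (F.P K) k),
      ‖NegSup.equiv (levWeight (F.L : ℝ) ((F.P K).eta k) levB 0) (Matrix (Fin N) (Fin N) ℂ)
        (fderiv ℂ (CslprOfRecord F N K k Ω U₀ (𝔥 K k U₀) levB) A (single115 (lev₁ := pairLevLit F Ω k) (Dc := nabla115 ((F.P K).eta k) (unitsOfRecord F N U₀)) bb X)) c‖ ≤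
        C₃ * (F.P K).eta k ^ (F.P K).d * ‖A‖ * ‖X‖ := by
  intro A hA bb X c
  have hsup := pi_norm_le_norm115 (F := F) (N := N) hΩ A
  have hi := h157 ⟨K, k, hk, Ω, levB, c, bb⟩ U₀ (plaqDevEta_lt_of_plaqSmall_pr F N 𝔥 ⟨K, k, hk, Ω, levB, c, bb⟩ hα₀ hU₀)
    (JetSup.equiv (levWeight (F.L : ℝ) ((F.P K).eta k) (bondLevLit F Ω k) 1) (levWeight (F.L : ℝ) ((F.P K).eta k) (pairLevLit F Ω k) 2) (nabla115 ((F.P K).eta k) (unitsOfRecord F N U₀)) A)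
    (by rw [kexpOfRecordPr_fldNorm]; exact lt_of_le_of_lt hsup hA)
  rw [kexpOfRecordPr_fldNorm] at hi
  have hη : 0 ≤ (F.P K).eta k ^ (F.P K).d := (pow_pos Fact.out _).le
  calc _ ≤ _ := entry_le_of_dCk_le_pr 𝔥 hk levB c bb hi X
    _ ≤ C₃ * (F.P K).eta k ^ (F.P K).d * ‖A‖ * ‖X‖ := by gcongr

/-- ★★★ **(KL-C)^{pr} BY NAME FROM `B7.Prop5Printed (kexpOfRecordPr F N 𝔥)`** — [B7] PROP. 5 (157) FOR THE RECORD's (0.4) AVERAGING ON THE FRAMED CHART of the frame family `𝔥`: there are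
`C₃, c₅ > 0` (print's `C₃ = 6C″₁` and its smallness threshold, chosen BEFORE `K, k, U₀`) such that for every approximation `K`, order `k ≤ m + K`, node-00 domain sequence (`Ω_k = T`), background
`U₀` with (52) at some `α₀ ≤ c₅`, radius `ρ ≤ c₅` and target weights `levB`: `‖(D C^{𝔰𝔩,pr}(A)·δ_b X)(c)‖ ≤ C₃η_k^d·‖A‖·‖X‖` on `‖A‖ < ρ`, `C^{𝔰𝔩,pr} = CslprOfRecord … (𝔥 K k U₀) levB` — the `hg` input of
the re-pressed cone doors with `g₀ := C₃η_k^d`.  HONEST: a reduction BY NAME; the hypothesis is an UNPROVED printed statement at the record whose truth DEPENDS ON `𝔥` (§6: false for the frameless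
family; print's Prop. 5 at def-Y's record inhabitant — dictionary row (d3), transport, XL). [cite: Balaban1985Averaging, Proposition 5 (156)–(157) p.42, (52) p.26, (92) p.31, (138) p.39; Balaban1985BackgroundPropagators, (3.113)–(3.114) p.418; Balaban1985Variational, (72)–(73) p.289, (86) p.291] -/
theorem klC_of_B7Prop5Printed_pr (h5 : B7.Prop5Printed (kexpOfRecordPr F N 𝔥)) :
    ∃ C₃ c₅ : ℝ, 0 < C₃ ∧ 0 < c₅ ∧
      ∀ (K k : ℕ) (hk : k ≤ (F.P K).m + (F.P K).K) (Ω : ℕ → Set (Site (F.P K) 0)) (U₀ : GaugeField (F.P K) 0 (SU N)) (levB : PBond (F.P K) k → ℕ)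
        [Fact (0 < (F.L : ℝ))] [Fact (0 < (F.P K).eta k)], (∀ x, x ∈ Ω k) →
        ∀ ⦃α₀ : ℝ⦄, 0 < α₀ → α₀ ≤ c₅ → PlaqSmall (α₀ * (F.P K).eta k ^ 2) U₀ → ∀ ⦃ρ : ℝ⦄, ρ ≤ c₅ →
        ∀ A : Space115Lit F N K k Ω U₀, ‖A‖ < ρ → ∀ (bb : Bond (F.P K).d (fun _ => (F.P K).sitesPerDir 0)) (X : Matrix (Fin N) (Fin N) ℂ) (c : PBond (F.P K) k),
          ‖NegSup.equiv (levWeight (F.L : ℝ) ((F.P K).eta k) levB 0) (Matrix (Fin N) (Fin N) ℂ)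
            (fderiv ℂ (CslprOfRecord F N K k Ω U₀ (𝔥 K k U₀) levB) A (single115 (lev₁ := pairLevLit F Ω k) (Dc := nabla115 ((F.P K).eta k) (unitsOfRecord F N U₀)) bb X)) c‖ ≤
            C₃ * (F.P K).eta k ^ (F.P K).d * ‖A‖ * ‖X‖ := by
  obtain ⟨C₁', C₃, c₅, -, hC₃, hc₅, h⟩ := h5
  refine ⟨C₃, c₅, hC₃, hc₅, fun K k hk Ω U₀ levB _ _ hΩ α₀ hα₀ hα₀5 hU₀ ρ hρ5 A hA bb X c => ?_⟩
  have hρ : 0 < ρ := lt_of_le_of_lt (norm_nonneg A) hA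
  exact coneLetter_of_prop5Clause_pr F N 𝔥 hk levB hΩ hC₃.le hα₀ (fun i U₀' hU' A' hA' => (h i α₀ ρ hα₀ hα₀5 hρ hρ5 U₀' hU' A' hA').2) hU₀ A hA bb X c

/-! ## §6  The honesty clause in the kernel: over def-Y's FRAMELESS datum the re-pressed family IS g0's frame-free one, whose Prop-5 hypothesis is refuted (Q-37); and the (157)-at-0 row -/

/-- ★ **THE FRAMELESS FAMILY IS g0's FRAME-FREE FAMILY**: over def-Y's vacuity-guard datum `FrameDatum.frameless k U₀` (`h = h⁻¹ = 1`, `Dh = 0`) at every `(K, k, U₀)`,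
`kexpOfRecordPr F N (fun K k U₀ => FrameDatum.frameless k U₀) = kexpOfRecord F N` (def-Y's `CslprOfRecord_frameless` ∕ `qPrCplxOp_frameless`). [cite: Balaban1985Averaging, (92) p.31, (127) p.37 (bookkeeping)] -/
theorem kexpOfRecordPr_frameless :
    kexpOfRecordPr F N (fun K k (U₀ : GaugeField (F.P K) 0 (SU N)) => FrameDatum.frameless k U₀) = kexpOfRecord F N := by
  funext i
  have hC : ∀ U₀ : GaugeField (F.P i.K) 0 (SU N),
      (haveI : Fact (0 < (F.L : ℝ)) := factL F; haveI : Fact (0 < (F.P i.K).eta i.k) := factEta F i.K i.k;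
        CslprOfRecord F N i.K i.k i.Ω U₀ (FrameDatum.frameless i.k U₀) i.levB) =
      (haveI : Fact (0 < (F.L : ℝ)) := factL F; haveI : Fact (0 < (F.P i.K).eta i.k) := factEta F i.K i.k;
        CslOfRecord F N i.K i.k i.Ω U₀ i.levB) := fun U₀ => by
    haveI : Fact (0 < (F.L : ℝ)) := factL F
    haveI : Fact (0 < (F.P i.K).eta i.k) := factEta F i.K i.k
    exact CslprOfRecord_frameless F N i.K i.k i.Ω U₀ i.levB
  have hq : ∀ U₀ : GaugeField (F.P i.K) 0 (SU N), qPrCplxOp i.k U₀ (FrameDatum.frameless i.k U₀) = qCplxOp i.k U₀ := fun U₀ =>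
    qPrCplxOp_frameless
  simp only [kexpOfRecordPr, kexpOfRecord, hC, hq]

/-- ★★ **HONESTY CLAUSE (Q-37 re-read)**: over the FRAMELESS datum family the hypothesis of `klC_of_B7Prop5Printed_pr` is FALSE (`N ≥ 2`) — it is literally
✓`not_B7Prop5Printed_kexpOfRecord`.  The road instance is def-Y's record inhabitant (file A1), not this one. [cite: Balaban1985Averaging, Proposition 5 (156) p.42, (147) p.40, (92) p.31; Balaban1987RG1, (0.6) p.253] -/
theorem not_B7Prop5Printed_kexpOfRecordPr_frameless (hN : 2 ≤ N) :
    ¬ B7.Prop5Printed (kexpOfRecordPr F N (fun K k (U₀ : GaugeField (F.P K) 0 (SU N)) => FrameDatum.frameless k U₀)) := by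
  rw [kexpOfRecordPr_frameless F N]
  exact not_B7Prop5Printed_kexpOfRecord F N hN

/-- ★ **THE (157)-AT-`A = 0` ROW ON THE FRAMED CHART, FOR EVERY DATUM**: under the record's guard of `U₀` below `k`, `dCk U₀ 0 = 0` — `D C^{𝔰𝔩,pr}(0) = 0` by def-Y's kernel guard
`hasFDerivAt_CslprOfRecord_zero_iff` (framed first-order token ⟺ frame-free) and PT-B's ✓`hasFDerivAt_CslOfRecord_zero` (`D C^{𝔰𝔩}(0) = 0`).  So the (157) conjunct is never violated at `A = 0`
(the place a sign slip between the frame placement and `Q^{pr}` would show — RR-2 READ 13 (α)). [cite: Balaban1985Averaging, Proposition 5 (157) p.42, (138) p.39; Balaban1985Variational, (44) p.285, (55) p.286] -/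
theorem kexpOfRecordPr_dCk_zero (i : KRecIdx F) (U₀ : GaugeField (F.P i.K) 0 (SU N)) (hU₀ : SmallBelow (avOfRecord F N i.K) i.k U₀) :
    (kexpOfRecordPr F N 𝔥 i).dCk U₀ (0 : Bond (F.P i.K).d (fun _ => (F.P i.K).sitesPerDir 0) → Matrix (Fin N) (Fin N) ℂ) = 0 := by
  haveI : Fact (0 < (F.L : ℝ)) := factL F
  haveI : Fact (0 < (F.P i.K).eta i.k) := factEta F i.K i.k
  have hD : HasFDerivAt (CslprOfRecord F N i.K i.k i.Ω U₀ (𝔥 i.K i.k U₀) i.levB)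
      (0 : Space115Lit F N i.K i.k i.Ω U₀ →L[ℂ] NegSize (F.L : ℝ) ((F.P i.K).eta i.k) i.levB 0 (Matrix (Fin N) (Fin N) ℂ)) 0 :=
    (hasFDerivAt_CslprOfRecord_zero_iff F N i.K i.k i.Ω U₀ (𝔥 i.K i.k U₀) i.levB hU₀).2
      (C44IterMh.hasFDerivAt_CslOfRecord_zero F i.k i.Ω U₀ i.levB hU₀)
  have h0 : (JetSup.equiv (levWeight (F.L : ℝ) ((F.P i.K).eta i.k) (bondLevLit F i.Ω i.k) 1) (levWeight (F.L : ℝ) ((F.P i.K).eta i.k) (pairLevLit F i.Ω i.k) 2)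
      (nabla115 ((F.P i.K).eta i.k) (unitsOfRecord F N U₀))).symm (0 : Bond (F.P i.K).d (fun _ => (F.P i.K).sitesPerDir 0) → Matrix (Fin N) (Fin N) ℂ) =
      (0 : Space115Lit F N i.K i.k i.Ω U₀) := rfl
  rw [kexpOfRecordPr_dCk, h0, hD.fderiv, ContinuousLinearMap.zero_comp, ContinuousLinearMap.comp_zero, norm_zero, mul_zero]

/-! ## §5  Fed into PT-B's re-pressed doors (✓`…C44IterMhConePr`): G1's (KL-C)^{pr} triple, and [B11] Prop. 4 at the record (node-00) on the framed chart — appended behind ✓`…C44IterMhConePr` (hand g2, append-only) -/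

/-- ★★ **G1's (KL-C)^{pr} TRIPLE FROM THE (157) CLAUSE** — PT-B's ✓`kernelLetterC_of_conePr` with its on-cone entry letter supplied by §4 (`g₀ := C₃η_k^d` on `‖A‖ < α₁`; the background's guard
`SmallBelow` and the DISPLAYED frame block-locality (hmap)∕(hderiv) are what F9ᵖʳ needs off the cone). [cite: Balaban1985Averaging, Proposition 5 (157) p.42, p.24, (92) p.31; Balaban1985Variational, (73) p.289, (86) p.291] -/
theorem kernelLetterC_of_prop5Clause_pr {K k : ℕ} (hk : k ≤ (F.P K).m + (F.P K).K) {Ω : ℕ → Set (Site (F.P K) 0)} {U₀ : GaugeField (F.P K) 0 (SU N)}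
    [Fact (0 < (F.L : ℝ))] [Fact (0 < (F.P K).eta k)] (levB : PBond (F.P K) k → ℕ) (hΩ : ∀ x, x ∈ Ω k) (hsm : SmallBelow (avOfRecord F N K) k U₀)
    (hmap : ∀ Y : Set (Site (F.P K) 0), (∀ i, i < k → ∀ s : Site (F.P K) i, toFine i s ∈ Y ↔ toFine (i + 1) (blockOf s) ∈ Y) →
      ∀ V V' : PBond (F.P K) 0 → Matrix (Fin N) (Fin N) ℂ, (∀ b : PBond (F.P K) 0, b ∈ bondsIn 0 Y → V b = V' b) →
      ∀ y : Site (F.P K) k, toFine k y ∈ Y → (𝔥 K k U₀).map V y = (𝔥 K k U₀).map V' y ∧ (𝔥 K k U₀).inv V y = (𝔥 K k U₀).inv V' y)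
    (hderiv : ∀ Y : Set (Site (F.P K) 0), (∀ i, i < k → ∀ s : Site (F.P K) i, toFine i s ∈ Y ↔ toFine (i + 1) (blockOf s) ∈ Y) →
      ∀ Z Z' : PBond (F.P K) 0 → Matrix (Fin N) (Fin N) ℂ, (∀ b : PBond (F.P K) 0, b ∈ bondsIn 0 Y → Z b = Z' b) →
      ∀ y : Site (F.P K) k, toFine k y ∈ Y → (𝔥 K k U₀).deriv Z y = (𝔥 K k U₀).deriv Z' y)
    {C₃ α₀ α₁ : ℝ} (hC₃ : 0 ≤ C₃) (hα₀ : 0 < α₀)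
    (h157 : ∀ (i : KRecIdx F) (U₀ : (kexpOfRecordPr F N 𝔥 i).Cfg), (kexpOfRecordPr F N 𝔥 i).plaqDevEta U₀ < α₀ →
      ∀ A : (kexpOfRecordPr F N 𝔥 i).Fld, (kexpOfRecordPr F N 𝔥 i).fldNorm A < α₁ → (kexpOfRecordPr F N 𝔥 i).dCk U₀ A ≤ C₃ * (kexpOfRecordPr F N 𝔥 i).fldNorm A)
    (hU₀ : PlaqSmall (α₀ * (F.P K).eta k ^ 2) U₀) :
    (∀ (c : PBond (F.P K) k) (bb : Bond (F.P K).d (fun _ => (F.P K).sitesPerDir 0)),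
      0 ≤ (if (bondToLit (F.P K) 0).symm bb ∈ bondsIn 0 {x : Site (F.P K) 0 | B14.Eq22Determines.blockIter k x = c.src ∨ B14.Eq22Determines.blockIter k x = c.tgt}
        then C₃ * (F.P K).eta k ^ (F.P K).d else 0)) ∧
    (∀ A : Space115Lit F N K k Ω U₀, ‖A‖ < α₁ → ∀ (bb : Bond (F.P K).d (fun _ => (F.P K).sitesPerDir 0)) (X : Matrix (Fin N) (Fin N) ℂ) (c : PBond (F.P K) k),
      ‖NegSup.equiv (levWeight (F.L : ℝ) ((F.P K).eta k) levB 0) (Matrix (Fin N) (Fin N) ℂ)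
        (fderiv ℂ (CslprOfRecord F N K k Ω U₀ (𝔥 K k U₀) levB) A (single115 (lev₁ := pairLevLit F Ω k) (Dc := nabla115 ((F.P K).eta k) (unitsOfRecord F N U₀)) bb X)) c‖ ≤
        (if (bondToLit (F.P K) 0).symm bb ∈ bondsIn 0 {x : Site (F.P K) 0 | B14.Eq22Determines.blockIter k x = c.src ∨ B14.Eq22Determines.blockIter k x = c.tgt}
          then C₃ * (F.P K).eta k ^ (F.P K).d else 0) * ‖A‖ * ‖X‖) ∧
    (∀ bb : Bond (F.P K).d (fun _ => (F.P K).sitesPerDir 0),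
      (∑ c : PBond (F.P K) k, (if (bondToLit (F.P K) 0).symm bb ∈ bondsIn 0 {x : Site (F.P K) 0 | B14.Eq22Determines.blockIter k x = c.src ∨ B14.Eq22Determines.blockIter k x = c.tgt}
        then C₃ * (F.P K).eta k ^ (F.P K).d else 0)) ≤ 2 * ((F.P K).d : ℝ) * (C₃ * (F.P K).eta k ^ (F.P K).d)) :=
  C44IterMh.kernelLetterC_of_conePr F N K k Ω U₀ hk (𝔥 K k U₀) levB hsm hmap hderiv (mul_nonneg hC₃ (pow_pos Fact.out _).le)
    fun A hA bb X c _ => coneLetter_of_prop5Clause_pr F N 𝔥 hk levB hΩ hC₃ hα₀ h157 hU₀ A hA bb X c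


section Prop4

variable (K k : ℕ) (Ω : ℕ → Set (Site (F.P K) 0)) (U₀ : GaugeField (F.P K) 0 (SU N))
variable [Fact (0 < (F.L : ℝ))] [Fact (0 < (F.P K).eta k)] [Fact (0 < c0Rec F K k)] [Fact (∀ c, 0 < wBRec F K k c)]

/-- ★★★ **[B11] PROP. 4 (97)–(98) AT THE RECORD (NODE-00) ON THE FRAMED CHART WITH ITS (KL-C)^{pr} BLOCK := [B7] PROP. 5 (157) FOR THE RECORD** — PT-B's ✓`prop4UniformPrAtRecord_node00_of_coneLetterPr`
with the on-cone entry letter supplied by §4 from the (157) clause of `B7.Prop5Printed (kexpOfRecordPr F N 𝔥)` at constants `(α, α₁, C₃)` (`α` = the (14) tower's, so (52) for `U₀` is its `j = 0` member;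
the door's closed-term radius `r` must satisfy `r + r ≤ α₁`): `g₀ := C₃η_k^d`, window `(r + r)·Θ_H·(2d·C₃η_k^d) ≤ ½`.  Remaining DISPLAYED letters: (ℓa-H)ᵖʳ, (KL-H)ᵖʳ, (KL-N)ᵖʳ, `‖J‖ ≤ nJ`, the frame
bounds `hc`∕(hdom)∕(hnear) and the frame block-locality (hmap)∕(hderiv) (def-Y's A1 debts for the record's inhabitant).  To use BY NAME: `obtain ⟨C₁', C₃, c₅, -, hC₃, hc₅, h⟩ := (h5 : B7.Prop5Printed
(kexpOfRecordPr F N 𝔥))` and pass `h157 := fun i U₀ hU A hA => (h i α α₁ hα hα5 hα₁ hα₁5 U₀ hU A hA).2` (`α, α₁ ≤ c₅`).  HONEST: glue; NO estimate of [B7]∕[B9]∕[B11] is proved here; at the junction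
`𝔥 := fun K k U₀ => hierFrameDatumOfRecord F N K k U₀` only. [cite: Balaban1985Variational, Prop. 4 (97)–(98) pp.292–293, (72)–(73) p.289, (86)–(89) p.291, (14) p.280; Balaban1985Averaging, Proposition 5 (157) p.42, (52) p.26, (92) p.31, (138) p.39; Balaban1985BackgroundPropagators, (3.113)–(3.114) p.418, (3.132) p.422] -/
theorem prop4UniformPrAtRecord_node00_of_prop5Clause_pr [DecidableEq (PBond (F.P K) k)] (levB : PBond (F.P K) k → ℕ) (a : ℝ)
    (hpos : ∀ x, x ≠ 0 → 0 < RCLike.re ⟪x, laplaceAOfRecord F N k U₀ (QprOfRecord F N k U₀ (𝔥 K k U₀)) (QprimeOfRecord F N k U₀) a x⟫_ℂ)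
    (hQ : Function.Surjective (QprOfRecord F N k U₀ (𝔥 K k U₀)))
    (Gp : SiteL2K ℂ (F.P K).d (fun _ => (F.P K).sitesPerDir 0) (c0Rec F K k) (WRec N) →ₗ[ℂ]
      SiteL2K ℂ (F.P K).d (fun _ => (F.P K).sitesPerDir 0) (c0Rec F K k) (WRec N))
    {b α nJ : ℝ} (hkpos : 0 < k) (hkm : k ≤ (F.P K).m + (F.P K).K) (hb : 0 ≤ b) (hΩ : ∀ x, x ∈ Ω k) (hαpos : 0 < α) (hα : α * (11000000 * N) ≤ 1)
    (hreg : ∀ j, j < k → PlaqSmall (α * ((F.L : ℝ) ^ j * (F.P K).eta k) ^ 2) (Averaging.iter (avOfRecord F N K) j U₀))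
    {c𝔥 : ℝ} (hc : c𝔥 ≤ 1000)
    (hdom : ∀ Y : PBond (F.P K) 0 → Matrix (Fin N) (Fin N) ℂ, (∀ b, (Y b).trace = 0) → (F.L : ℝ) ^ k * ‖Y‖ < 1 / (25000000000 * (F.L : ℝ) * N) →
      expOver U₀ Y ∈ (𝔥 K k U₀).dom)
    (hnear : ∀ Y : PBond (F.P K) 0 → Matrix (Fin N) (Fin N) ℂ, (∀ b, (Y b).trace = 0) → (F.L : ℝ) ^ k * ‖Y‖ < 1 / (25000000000 * (F.L : ℝ) * N) →
      ∀ y : Site (F.P K) k, ‖(𝔥 K k U₀).map (expOver U₀ Y) y - 1‖ ≤ c𝔥 * ((F.L : ℝ) ^ k * ‖Y‖) ∧ ‖(𝔥 K k U₀).inv (expOver U₀ Y) y - 1‖ ≤ c𝔥 * ((F.L : ℝ) ^ k * ‖Y‖))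
    (hmap : ∀ Y : Set (Site (F.P K) 0), (∀ i, i < k → ∀ s : Site (F.P K) i, toFine i s ∈ Y ↔ toFine (i + 1) (blockOf s) ∈ Y) →
      ∀ V V' : PBond (F.P K) 0 → Matrix (Fin N) (Fin N) ℂ, (∀ b : PBond (F.P K) 0, b ∈ bondsIn 0 Y → V b = V' b) →
      ∀ y : Site (F.P K) k, toFine k y ∈ Y → (𝔥 K k U₀).map V y = (𝔥 K k U₀).map V' y ∧ (𝔥 K k U₀).inv V y = (𝔥 K k U₀).inv V' y)
    (hderiv : ∀ Y : Set (Site (F.P K) 0), (∀ i, i < k → ∀ s : Site (F.P K) i, toFine i s ∈ Y ↔ toFine (i + 1) (blockOf s) ∈ Y) →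
      ∀ Z Z' : PBond (F.P K) 0 → Matrix (Fin N) (Fin N) ℂ, (∀ b : PBond (F.P K) 0, b ∈ bondsIn 0 Y → Z b = Z' b) →
      ∀ y : Site (F.P K) k, toFine k y ∈ Y → (𝔥 K k U₀).deriv Z y = (𝔥 K k U₀).deriv Z' y)
    (hH : Prop4LetterHPrAtRecord F N K k Ω U₀ (𝔥 K k U₀) levB a hpos hQ b)
    -- (KL-H)ᵖʳ
    {hk : Bond (F.P K).d (fun _ => (F.P K).sitesPerDir 0) → PBond (F.P K) k → ℝ} (hk0 : ∀ b' y, 0 ≤ hk b' y)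
    (hHk : ∀ (y : PBond (F.P K) k) (Z : Matrix (Fin N) (Fin N) ℂ) (b' : Bond (F.P K).d (fun _ => (F.P K).sitesPerDir 0)),
      ‖flat115 (H1prOfRecordAtBg F N K k Ω U₀ (𝔥 K k U₀) levB a hpos hQ
          ((NegSup.equiv (levWeight (F.L : ℝ) ((F.P K).eta k) levB 0) (Matrix (Fin N) (Fin N) ℂ)).symm (Pi.single y Z))) b'‖ ≤ hk b' y * ‖Z‖)
    {ΘH : ℝ} (hΘH : 0 ≤ ΘH) (hH1 : ∀ y, ∑ b', hk b' y ≤ ΘH) {ΘHw : ℝ} (hΘHw : 0 ≤ ΘHw)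
    (hHw : ∀ (bb : Bond (F.P K).d (fun _ => (F.P K).sitesPerDir 0)) (y : PBond (F.P K) k),
      ∑ b', levWeight (F.L : ℝ) ((F.P K).eta k) (bondLevLit F Ω k) 3 bb / levWeight (F.L : ℝ) ((F.P K).eta k) (bondLevLit F Ω k) 3 b' * hk b' y ≤ ΘHw)
    -- (KL-C)ᵖʳ := the (157) clause of `B7.Prop5Printed (kexpOfRecordPr F N 𝔥)` at `(α, α₁, C₃)`, `r + r ≤ α₁`, and the window
    {C₃ α₁ : ℝ} (hC₃ : 0 ≤ C₃)
    (h157 : ∀ (i : KRecIdx F) (U₀ : (kexpOfRecordPr F N 𝔥 i).Cfg), (kexpOfRecordPr F N 𝔥 i).plaqDevEta U₀ < α →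
      ∀ A : (kexpOfRecordPr F N 𝔥 i).Fld, (kexpOfRecordPr F N 𝔥 i).fldNorm A < α₁ → (kexpOfRecordPr F N 𝔥 i).dCk U₀ A ≤ C₃ * (kexpOfRecordPr F N 𝔥 i).fldNorm A)
    (hrα₁ : letI C₂ : ℝ := 32000000000000000 * (F.L : ℝ) * N
      letI c₄ : ℝ := 1 / (200000000000 * (F.L : ℝ) * N)
      letI r : ℝ := min (c₄ / 4) (min (1 / 2) (1 / (16 * (b * C₂ + 1))))
      r + r ≤ α₁)
    (hq : letI C₂ : ℝ := 32000000000000000 * (F.L : ℝ) * N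
      letI c₄ : ℝ := 1 / (200000000000 * (F.L : ℝ) * N)
      letI r : ℝ := min (c₄ / 4) (min (1 / 2) (1 / (16 * (b * C₂ + 1))))
      (r + r) * ΘH * (2 * ((F.P K).d : ℝ) * (C₃ * (F.P K).eta k ^ (F.P K).d)) ≤ 1 / 2)
    -- (KL-N)ᵖʳ
    {hk' : Bond (F.P K).d (fun _ => (F.P K).sitesPerDir 0) → PBond (F.P K) k → ℝ} (hk'0 : ∀ b' y, 0 ≤ hk' b' y)
    (hNk : ∀ (y : PBond (F.P K) k) (Z : Matrix (Fin N) (Fin N) ℂ) (b' : Bond (F.P K).d (fun _ => (F.P K).sitesPerDir 0)),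
      ‖NegSup.equiv (levWeight (F.L : ℝ) ((F.P K).eta k) (bondLevLit F Ω k) 3) (Matrix (Fin N) (Fin N) ℂ)
        (DeltaPiCurOfRecord F N K k Ω U₀ Gp (QprimeOfRecord F N k U₀) (H1prOfRecordAtBg F N K k Ω U₀ (𝔥 K k U₀) levB a hpos hQ
          ((NegSup.equiv (levWeight (F.L : ℝ) ((F.P K).eta k) levB 0) (Matrix (Fin N) (Fin N) ℂ)).symm (Pi.single y Z)))) b'‖ ≤ hk' b' y * ‖Z‖)
    {Θ' : ℝ} (hΘ'0 : 0 ≤ Θ')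
    (hΘ' : ∀ (bb : Bond (F.P K).d (fun _ => (F.P K).sitesPerDir 0)) (y : PBond (F.P K) k),
      ∑ b', levWeight (F.L : ℝ) ((F.P K).eta k) (bondLevLit F Ω k) 3 bb / levWeight (F.L : ℝ) ((F.P K).eta k) (bondLevLit F Ω k) 1 b' * hk' b' y ≤ Θ')
    {N₁ : ℝ} (hN₁0 : 0 ≤ N₁)
    (hN₁ : ∀ b', ∑ y, levWeight (F.L : ℝ) ((F.P K).eta k) (bondLevLit F Ω k) 3 b' / levWeight (F.L : ℝ) ((F.P K).eta k) levB 0 y * hk' b' y ≤ N₁)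
    (hJ : ‖JOfRecordAtBg F N K k Ω U₀‖ ≤ nJ) :
    letI C₂ : ℝ := 32000000000000000 * (F.L : ℝ) * N
    letI c₄ : ℝ := 1 / (200000000000 * (F.L : ℝ) * N)
    letI r : ℝ := min (c₄ / 4) (min (1 / 2) (1 / (16 * (b * C₂ + 1))))
    letI R' : ℝ := min r ((1 - 4 * b * C₂ * (r + r)) * (1 / 16))
    letI CV : ℝ := 1024 * (((F.P K).d - 1 : ℕ) : ℝ) * ((1 : ℝ) * 1) ^ 3 * N * (α * (1 : ℝ) ^ 2 + 1 / 16)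
        + (((F.P K).d - 1 : ℕ) : ℝ) * ((1 : ℝ) * 1) ^ 3 * (136 + 2 * ((1 : ℝ) * 1)) * N
    letI G : ℝ := 2 * ((F.P K).d : ℝ) * (C₃ * (F.P K).eta k ^ (F.P K).d)
    letI θ₃ : ℝ := (2 * (1 / (1 - 4 * b * C₂ * (r + r))) + 1) * ΘHw * G / r
    letI θE : ℝ := 2 * ΘHw * G * (1 / (1 - 4 * b * C₂ * (r + r)))
    letI θE' : ℝ := 2 * Θ' * G * (1 / (1 - 4 * b * C₂ * (r + r)))
    Prop4UniformPrAtRecord F N K k Ω U₀ (𝔥 K k U₀) levB a hpos hQ r Gp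
      ((N * θ₃ * nJ + (N₁ * C₂ * (1 / (1 - 4 * b * C₂ * (r + r))) ^ 2 + N * θE')
        + N * θE * (N₁ * C₂ * (1 / (1 - 4 * b * C₂ * (r + r))) ^ 2) * R'
        + N * (1 + θE * R') * CV * (1 / (1 - 4 * b * C₂ * (r + r))) ^ 2)) R' :=
  C44IterMh.prop4UniformPrAtRecord_node00_of_coneLetterPr F N K k Ω U₀ (𝔥 K k U₀) levB a hpos hQ Gp hkpos hkm hb hΩ hαpos.le hα hreg hc hdom hnear hmap hderiv hH hk0 hHk hΘH hH1
    hΘHw hHw (mul_nonneg hC₃ (pow_pos Fact.out _).le)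
    (fun A hA bb X c _ => coneLetter_of_prop5Clause_pr F N 𝔥 hkm levB hΩ hC₃ hαpos h157 (C44IterMh.plaqSmall_base_of_hreg F N U₀ hkpos hreg) A (lt_of_lt_of_le hA hrα₁) bb X c)
    hq hk'0 hNk hΘ'0 hΘ' hN₁0 hN₁ hJ

end Prop4

end Summit.QuantumFields.YangMills.Theorems.KExpOfRecordPr

end
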